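import Summits.Ventures.HodgeRepro.FaceCensusEngine
import Summits.Ventures.HodgeRepro.Groups

/-!
# Cayley tables of the concrete groups, in the sealer's `CMGaloisType` format

Blind re-derivation cell `pub-hodge-repro`, seat `typer` (gen 2).  Bridge from the Mathlib groups of
`Groups.lean` to the census engine `Summit.Ventures.HodgeRepro.FaceCensus` (the sealer's
`FaceCensusEngine.lean`): an enumeration `e : G ≃ Fin n` turns `(G, c)` into a Cayley table
`tableOf e c : CMGaloisType n`, whose `Bool` axioms hold because `G` is a group and `c` a central
involution (`isCMGaloisType_tableOf`, generic — no `decide`).  A census row `Γ` of the engine is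
identified with a concrete group by the decidable equality `Γ = tableOf e c`.
-/

set_option autoImplicit false

open Finset
open Summit.Ventures.HodgeRepro.FaceCensus

namespace HodgeRepro

section Generic

variable {G : Type*} [Group G] {n : ℕ}

/-- The Cayley table of `(G, c)` along the enumeration `e : G ≃ Fin n`. -/
def tableOf (e : G ≃ Fin n) (c : G) : CMGaloisType n :=
  ⟨fun i j => e (e.symm i * e.symm j), e 1, e c⟩

/-- Multiplication in the Cayley table. -/
@[simp] theorem tableOf_mul (e : G ≃ Fin n) (c : G) (i j : Fin n) :
    (tableOf e c).mul i j = e (e.symm i * e.symm j) := rfl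

/-- The identity of the Cayley table. -/
@[simp] theorem tableOf_one (e : G ≃ Fin n) (c : G) : (tableOf e c).one = e 1 := rfl

/-- The conjugation of the Cayley table. -/
@[simp] theorem tableOf_conj (e : G ≃ Fin n) (c : G) : (tableOf e c).conj = e c := rfl

/-- The `Bool` axioms of the engine hold for the Cayley table of a group with a central involution. -/
theorem isCMGaloisType_tableOf (e : G ≃ Fin n) {c : G} (hc : IsComplexConj c) :
    (tableOf e c).isCMGaloisType = true := by
  simp only [CMGaloisType.isCMGaloisType, tableOf_mul, tableOf_one, tableOf_conj, List.all_eq_true,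
    List.mem_finRange, true_implies, Bool.and_eq_true, beq_iff_eq, List.any_eq_true,
    Bool.not_eq_eq_eq_not, Bool.not_true, beq_eq_false_iff_ne, ne_eq, Equiv.symm_apply_apply]
  refine ⟨⟨⟨⟨⟨fun i j k => ?_, fun i => ⟨?_, ?_⟩⟩, fun i => ?_⟩, fun i => ?_⟩, ?_⟩, ?_⟩
  · rw [mul_assoc]
  · simp
  · simp
  · exact ⟨e (e.symm i)⁻¹, by simp⟩
  · rw [hc.comm]
  · rw [hc.mul_self]
  · exact fun h => hc.ne_one (e.injective h)

end Generic

/-! ### Enumerations of the concrete groups of `Groups.lean` -/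

section Concrete

/-- `C₆ ≃ Fin 6` (`ZMod 6 = Fin 6`). -/
def encC6 : C6 ≃ Fin 6 := Multiplicative.toAdd

/-- `C₈ ≃ Fin 8`. -/
def encC8 : C8 ≃ Fin 8 := Multiplicative.toAdd

/-- `C₁₂ ≃ Fin 12`. -/
def encC12 : C12 ≃ Fin 12 := Multiplicative.toAdd

/-- `C₄ × C₂ ≃ Fin 8`, `(a, b) ↦ a + 4 b`. -/
def encC4xC2 : C4xC2 ≃ Fin 8 := Multiplicative.toAdd.trans finProdFinEquiv

/-- `C₆ × C₂ ≃ Fin 12`, `(a, b) ↦ a + 6 b`. -/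
def encC6xC2 : C6xC2 ≃ Fin 12 := Multiplicative.toAdd.trans finProdFinEquiv

/-- `C₂ × C₂ × C₂ ≃ Fin 8`. -/
def encC2xC2xC2 : C2xC2xC2 ≃ Fin 8 :=
  Multiplicative.toAdd.trans ((Equiv.prodCongr (Equiv.refl (Fin 2)) finProdFinEquiv).trans finProdFinEquiv)

/-- `D₄ ≃ Fin 8`: `r i ↦ i`, `sr i ↦ 4 + i`. -/
def encD4 : D4 ≃ Fin 8 where
  toFun x := match x with
    | .r i => ⟨i.val, by have := i.val_lt; omega⟩
    | .sr i => ⟨4 + i.val, by have := i.val_lt; omega⟩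
  invFun k := if k.val < 4 then .r (k.val : ZMod 4) else .sr ((k.val - 4 : ℕ) : ZMod 4)
  left_inv := by decide
  right_inv := by decide

/-- `D₆ ≃ Fin 12`: `r i ↦ i`, `sr i ↦ 6 + i`. -/
def encD6 : D6 ≃ Fin 12 where
  toFun x := match x with
    | .r i => ⟨i.val, by have := i.val_lt; omega⟩
    | .sr i => ⟨6 + i.val, by have := i.val_lt; omega⟩
  invFun k := if k.val < 6 then .r (k.val : ZMod 6) else .sr ((k.val - 6 : ℕ) : ZMod 6)
  left_inv := by decide
  right_inv := by decide

/-- `Q₈ ≃ Fin 8`: `a i ↦ i`, `xa i ↦ 4 + i`. -/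
def encQ8 : Q8 ≃ Fin 8 where
  toFun x := match x with
    | .a i => ⟨i.val, by have := i.val_lt; omega⟩
    | .xa i => ⟨4 + i.val, by have := i.val_lt; omega⟩
  invFun k := if k.val < 4 then .a (k.val : ZMod 4) else .xa ((k.val - 4 : ℕ) : ZMod 4)
  left_inv := by decide
  right_inv := by decide

/-- `Dic₃ ≃ Fin 12`: `a i ↦ i`, `xa i ↦ 6 + i`. -/
def encDic3 : Dic3 ≃ Fin 12 where
  toFun x := match x with
    | .a i => ⟨i.val, by have := i.val_lt; omega⟩
    | .xa i => ⟨6 + i.val, by have := i.val_lt; omega⟩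
  invFun k := if k.val < 6 then .a (k.val : ZMod 6) else .xa ((k.val - 6 : ℕ) : ZMod 6)
  left_inv := by decide
  right_inv := by decide

/-! ### The Cayley tables of the ten `(G, c)` pairs (one representative involution each) -/

/-- The Cayley table of `C₆`. -/
def tableC6 : CMGaloisType 6 := tableOf encC6 cc_C6
/-- The table of `C₆` passes the engine's `Bool` axioms. -/
theorem tableC6_isCMGaloisType : tableC6.isCMGaloisType = true :=
  isCMGaloisType_tableOf encC6 cc_C6_isComplexConj

/-- The Cayley table of `C₈`. -/
def tableC8 : CMGaloisType 8 := tableOf encC8 cc_C8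
/-- The table of `C₈` passes the engine's `Bool` axioms. -/
theorem tableC8_isCMGaloisType : tableC8.isCMGaloisType = true :=
  isCMGaloisType_tableOf encC8 cc_C8_isComplexConj

/-- The Cayley table of `C₄ × C₂` with the square involution `(2, 0)`. -/
def tableC4xC2 : CMGaloisType 8 := tableOf encC4xC2 cc_C4xC2_sq
/-- The table of `C₄ × C₂` (square involution) passes the engine's `Bool` axioms. -/
theorem tableC4xC2_isCMGaloisType : tableC4xC2.isCMGaloisType = true :=
  isCMGaloisType_tableOf encC4xC2 cc_C4xC2_sq_isComplexConj

/-- The Cayley table of `C₄ × C₂` with the non-square involution `(0, 1)`. -/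
def tableC4xC2' : CMGaloisType 8 := tableOf encC4xC2 cc_C4xC2_ns
/-- The table of `C₄ × C₂` (non-square involution) passes the engine's `Bool` axioms. -/
theorem tableC4xC2'_isCMGaloisType : tableC4xC2'.isCMGaloisType = true :=
  isCMGaloisType_tableOf encC4xC2 cc_C4xC2_ns_isComplexConj

/-- The Cayley table of `C₂ × C₂ × C₂`. -/
def tableC2xC2xC2 : CMGaloisType 8 := tableOf encC2xC2xC2 cc_C2xC2xC2
/-- The table of `C₂³` passes the engine's `Bool` axioms. -/
theorem tableC2xC2xC2_isCMGaloisType : tableC2xC2xC2.isCMGaloisType = true :=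
  isCMGaloisType_tableOf encC2xC2xC2 cc_C2xC2xC2_isComplexConj

/-- The Cayley table of `D₄`. -/
def tableD4 : CMGaloisType 8 := tableOf encD4 cc_D4
/-- The table of `D₄` passes the engine's `Bool` axioms. -/
theorem tableD4_isCMGaloisType : tableD4.isCMGaloisType = true :=
  isCMGaloisType_tableOf encD4 cc_D4_isComplexConj

/-- The Cayley table of `Q₈`. -/
def tableQ8 : CMGaloisType 8 := tableOf encQ8 cc_Q8
/-- The table of `Q₈` passes the engine's `Bool` axioms. -/
theorem tableQ8_isCMGaloisType : tableQ8.isCMGaloisType = true :=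
  isCMGaloisType_tableOf encQ8 cc_Q8_isComplexConj

/-- The Cayley table of `C₁₂`. -/
def tableC12 : CMGaloisType 12 := tableOf encC12 cc_C12
/-- The table of `C₁₂` passes the engine's `Bool` axioms. -/
theorem tableC12_isCMGaloisType : tableC12.isCMGaloisType = true :=
  isCMGaloisType_tableOf encC12 cc_C12_isComplexConj

/-- The Cayley table of `C₆ × C₂` with the involution `(3, 0)`. -/
def tableC6xC2 : CMGaloisType 12 := tableOf encC6xC2 cc_C6xC2
/-- The table of `C₆ × C₂` passes the engine's `Bool` axioms. -/
theorem tableC6xC2_isCMGaloisType : tableC6xC2.isCMGaloisType = true :=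
  isCMGaloisType_tableOf encC6xC2 cc_C6xC2_isComplexConj

/-- The Cayley table of `D₆`. -/
def tableD6 : CMGaloisType 12 := tableOf encD6 cc_D6
/-- The table of `D₆` passes the engine's `Bool` axioms. -/
theorem tableD6_isCMGaloisType : tableD6.isCMGaloisType = true :=
  isCMGaloisType_tableOf encD6 cc_D6_isComplexConj

/-- The Cayley table of `Dic₃`. -/
def tableDic3 : CMGaloisType 12 := tableOf encDic3 cc_Dic3
/-- The table of `Dic₃` passes the engine's `Bool` axioms. -/
theorem tableDic3_isCMGaloisType : tableDic3.isCMGaloisType = true :=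
  isCMGaloisType_tableOf encDic3 cc_Dic3_isComplexConj

/-- Sanity: the engine's CM-type count on the table of `C₆` (kernel `decide`). -/
theorem tableC6_cmTypes_length : tableC6.cmTypes.length = 8 := by decide +kernel

end Concrete

/-! ### Matching a closed-formula table (the shape of a census row) with a concrete group -/

/-- `D₆` multiplication as a closed formula on indices (`i < 6` is `r^i`, `6 + i` is `s r^i`), the shape
in which a census row presents its Cayley table. -/
def d6mul (i j : ℕ) : ℕ :=
  if i < 6 then (if j < 6 then (i + j) % 6 else 6 + (j - 6 + 6 - i) % 6)
  else (if j < 6 then 6 + (i - 6 + j) % 6 else (j - 6 + 6 - (i - 6)) % 6)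

/-- The closed-formula table of `D₆`. -/
def tableD6' : CMGaloisType 12 :=
  ⟨fun i j => ⟨d6mul i.val j.val % 12, Nat.mod_lt _ (by decide)⟩, ⟨0, by decide⟩, ⟨3, by decide⟩⟩

/-- A row table is identified with the concrete group by a decidable check of the three fields. -/
theorem tableD6'_eq_tableD6 :
    (∀ i j, tableD6'.mul i j = tableD6.mul i j) ∧ tableD6'.one = tableD6.one ∧
      tableD6'.conj = tableD6.conj := by
  decide

/-- Hence the two tables are equal as `CMGaloisType 12` (structure eta). -/
theorem tableD6'_eq : tableD6' = tableD6 := by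
  obtain ⟨h1, h2, h3⟩ := tableD6'_eq_tableD6
  cases' hD : tableD6' with m o c
  cases' hD' : tableD6 with m' o' c'
  rw [hD, hD'] at h1 h2 h3
  simp only at h1 h2 h3
  congr 1
  · funext i j; exact h1 i j

end HodgeRepro
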